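import Literature.Barriers.CriticalPhenomena.GridSAWCountingGridHamPathHardness
import Literature.Barriers.CriticalPhenomena.GridSAWCountingVerifier
import Literature.Barriers.CriticalPhenomena.GridSAWTowersMachine
import Literature.Computability.Complexity.ParsimoniousThreeCNFMachine
import HarnessLib

/-!
# Theorem 7 (1) of LOT2003 from the gadget step alone

Of the five steps of `LOT2003_thm7_fixedLength_of_steps` (`GridSAWCountingGridHamPathHardness.lean`)
four are discharged in the tree: membership (`LOT2003_thm7_fixedLength_mem_holds`,
`GridSAWCountingVerifier.lean`), Proposition 2 for `#3SAT` (`LOT2003_prop2_sharp3SAT_holds`,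
`ParsimoniousThreeCNFMachine.lean`), Lemma 3 (`LOT2003_lemma3_holds`, `SharpSATNormalFormFP.lean`)
and the towers (`LOT2003_thm7_fixedLength_towers_holds`, `GridSAWTowersMachine.lean`). What remains
of Theorem 7 (1) is the gadget reduction with the grid embedding, `LOT2003_lemma4_gadgets`.

## References

* M. Liśkiewicz, M. Ogihara, S. Toda, TCS 304 (2003) 129–156, Theorem 7 (1) and its proof (§4),
  Lemma 4 (§3).
-/

namespace Literature.Barriers.CriticalPhenomena.GridSAW

open Literature.Computability.Complexity (LOT2003_prop2_sharp3SAT_holds LOT2003_lemma3_holds)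

/-- **What remains of Theorem 7 (1)**: `#P`-completeness of `#SAW(E, s, t)` under `≤ᵖ_{r-shift}`
follows from the gadget reduction with embedding `#3SAT_NF ≤ᵖ_{r-shift} GRIDHAMPATHCOUNT` alone.
[cite: LiskiewiczOgiharaToda2003, Theorem 7 (1), proof in §4] -/
theorem LOT2003_thm7_fixedLength_of_gadgets (h4 : LOT2003_lemma4_gadgets) : LOT2003_thm7_fixedLength :=
  LOT2003_thm7_fixedLength_of_steps LOT2003_thm7_fixedLength_mem_holds LOT2003_prop2_sharp3SAT_holds
    LOT2003_lemma3_holds h4 LOT2003_thm7_fixedLength_towers_holds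

end Literature.Barriers.CriticalPhenomena.GridSAW
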